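import Mathlib

/-!
# `BalabanImbrieJaffe1984to88.BIJ85AppAStatements` — T. Bałaban, J. Imbrie, A. Jaffe, *Renormalization of the Higgs model:
minimizers, propagators and the stability of mean field theory*, Commun. Math. Phys. **97** (1985) 299–329
[BalabanImbrieJaffe1985]: Appendix "Quadratic Forms" — **Proposition A1** (A2)–(A3) and **Corollary A2** (A4) PROVED in the
abstract inner-product form printed, the constrained objects (A7)–(A12) and **Proposition A3** (A13)–(A16), with the printed
verification of (A14) kernel-checked as operator algebra

statement-level skeleton of published theorems with citation tags; proofs where landed; nothing here is a claim about the Yang–Mills mass gap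

PDF held: `paper:balaban1985-cmp97-bij-higgs-minimizers` (journal page = PDF page + 298).  Renders read as images: PDF pp. 28–30
(journal 326–328): `run/shared/lean/pub/pub-balaban/b2b-balaban-beta-lit3-g10/pages/…-p028-x2.png`,
`run/shared/lean/pub/lit-balaban/lit-balaban-r15/pages/…-p029,p030-x2.png`.

CITATION HEADER (lean-in-tree rule).  Part of the lit-balaban TYPED SKELETON (HOME `run/shared/lean/pub/lit-balaban/`; rows
C1.EqA1, C1.PropA1, C1.CorA2, C1.EqA7–A12, C1.PropA3 of `HOME/lit-balaban-r15/ROWS-C1-part2.md`).  p. 326: *"Since we work with lattice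
fields, our space ℋ is finite dimensional and all forms are bounded."*  WHAT IS REPRODUCED, and how.  (a) (A1) h(A) = ½‖αA + B‖² as a
real definition over real inner product spaces E (∋ A) and F (∋ B) with a linear α : E → F and its adjoint α* (carried as a map
with the adjoint identity as hypothesis — finite dimension makes it exist; not constructed here); **Corollary A2** (A4) PROVED
from the normal equation α*(αA_cl + B) = 0 (which is (A3) A_cl = −Δ^{−1}α*B read without inverting Δ = α*α: ΔA_cl = −α*B), and the
minimum property of **Proposition A1** (A2) "h(A) ≥ h(A_cl)" PROVED from it; the value h(A_cl) = ½⟨B,(I−P)B⟩ PROVED from "αA_cl =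
−PB, P the (orthogonal) projection onto Range α" in the form ‖(I−P)B‖² = ⟨B,(I−P)B⟩ for a self-adjoint idempotent I − P.  NOT
proved here: "Range α* = Domain Δ^{−1}, so P = αΔ^{−1}α*" and uniqueness of the minimum (typed in `PropA1`'s docstring; rows).
(b) **Proposition A3** over an abstract carrier of linear operators on ℋ with ℋ₀ = Null V ((A8)–(A12)): (A13) C = PG, (A14) CΔ₀C = C,
(A15)–(A16) as `def … : Prop`; the printed verification of (A14) from (A13) — *"CΔ₀C = PGΔ₀PG = PG(Δ+V)PG = P²G = PG = C"* —
KERNEL-CHECKED as operator algebra (`eqA14_of_A13`) from exactly the facts it uses (Δ₀ = Δ + V on ℋ₀ ⊇ Range P, G(Δ+V) = I, P² = P).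
NOTHING of the paper is asserted beyond the kernel-checked statements.  Unit `lit-balaban-r15` (second reader of C1, "rest" =
Sects. 4–7 + Appendix per SKELETON.md §1 Rule 3).
-/

open scoped InnerProductSpace

namespace Literature.MathematicalPhysics.QuantumFieldTheory.BalabanImbrieJaffe1984to88.BIJ85AppAStatements

/-! ## (A1)–(A4): Proposition A1 and Corollary A2 -/

section PropA1

variable {E F : Type*} [NormedAddCommGroup E] [InnerProductSpace ℝ E] [NormedAddCommGroup F] [InnerProductSpace ℝ F]

/-- **(A1)** p. 326 [PDF 28], verbatim: *"As a first example, let 0 ≤ Δ = α*α be a self-adjoint transformation on ℋ and let B ∈ ℋ.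
Define the quadratic form h(A) = ½‖αA + B‖². (A1) Let P denote the projection onto Range(α)."* — for a linear α : E → F between
real inner product spaces (E = F = ℋ in print). [cite: BalabanImbrieJaffe1985, (A1) p.326] -/
noncomputable def hForm (α : E →ₗ[ℝ] F) (B : F) (A : E) : ℝ :=
  (1 / 2) * ‖α A + B‖ ^ 2

/-- **Corollary A2** p. 327 [PDF 29], verbatim: *"If we translate the quadratic form h, using the change of variables A = A′ + A_cl,
then as a consequence of (I − P)α = 0, and h(A_cl) = ½⟨B,(I−P)B⟩, h(A) decomposes into a sum of independent quadratic forms. We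
state Corollary A2. With h(A) given by (A1) and A = A′ + A_cl defined by (A3), h(A) = ½⟨A′, ΔA′⟩ + h(A_cl). (A4)"* — PROVED, with
Δ = α*α entering through ⟨A′, ΔA′⟩ = ⟨αA′, αA′⟩ (`hadj`: α* is the adjoint of α) and (A3) A_cl = −Δ^{−1}α*B entering as the normal
equation α*(αA_cl + B) = 0. [cite: BalabanImbrieJaffe1985, Cor. A2 (A4) p.327] -/
theorem corA2 (α : E →ₗ[ℝ] F) (αadj : F →ₗ[ℝ] E) (hadj : ∀ (x : E) (y : F), ⟪α x, y⟫_ℝ = ⟪x, αadj y⟫_ℝ) (B : F)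
    (Acl : E) (hnormal : αadj (α Acl + B) = 0) (A' : E) :
    hForm α B (A' + Acl) = (1 / 2) * ⟪A', αadj (α A')⟫_ℝ + hForm α B Acl := by
  unfold hForm
  have hsplit : α (A' + Acl) + B = α A' + (α Acl + B) := by
    rw [map_add, add_assoc]
  have hcross : ⟪α A', α Acl + B⟫_ℝ = 0 := by
    rw [hadj, hnormal, inner_zero_right]
  rw [hsplit, norm_add_sq_real, hcross, mul_zero, add_zero, ← hadj, real_inner_self_eq_norm_sq]
  ring

/-- **Proposition A1** p. 327 [PDF 29], the minimum property, verbatim: *"Proposition A1. Range α* = Domain Δ^{−1}, so P = αΔ^{−1}α*.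
Furthermore h(A) ≥ h(A_cl) = ½⟨B,(I−P)B⟩, (A2) where A_cl = −Δ^{−1}α*B (A3) is the unique minimum of (A1)."* — the inequality
h(A) ≥ h(A_cl) PROVED for every A_cl satisfying the normal equation α*(αA_cl + B) = 0 (= (A3) multiplied by Δ), from Corollary A2
and ⟨αA′, αA′⟩ ≥ 0.  NOT typed here: the range statement, the formula for P, uniqueness ("Since h(A) is convex, the minimum is
unique") — rows only. [cite: BalabanImbrieJaffe1985, Prop. A1 (A2) p.327] -/
theorem propA1_min (α : E →ₗ[ℝ] F) (αadj : F →ₗ[ℝ] E) (hadj : ∀ (x : E) (y : F), ⟪α x, y⟫_ℝ = ⟪x, αadj y⟫_ℝ) (B : F)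
    (Acl : E) (hnormal : αadj (α Acl + B) = 0) (A : E) : hForm α B Acl ≤ hForm α B A := by
  have h := corA2 α αadj hadj B Acl hnormal (A - Acl)
  rw [sub_add_cancel] at h
  rw [h, ← hadj, real_inner_self_eq_norm_sq]
  have : 0 ≤ (1 / 2 : ℝ) * ‖α (A - Acl)‖ ^ 2 := by positivity
  linarith

/-- **(A2)**, the value at the minimum, p. 327 [PDF 29]: "h(A_cl) = ½⟨B,(I−P)B⟩" — PROVED in the form the printed argument gives it
(*"P² = P = P*, and Pα = α. Thus P is the projection onto Range α. Writing h(A) = ½‖Δ^{1/2}A + Δ^{−1/2}α*B‖² + ½⟨B,(I−P)B⟩ yields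
(A2)"*): if αA_cl + B = QB for a self-adjoint idempotent Q (= I − P), then h(A_cl) = ½⟨B, QB⟩.
[cite: BalabanImbrieJaffe1985, Prop. A1 (A2) p.327] -/
theorem hForm_min_eq (α : E →ₗ[ℝ] F) (B : F) (Acl : E) (Q : F →ₗ[ℝ] F)
    (hQself : ∀ x y : F, ⟪Q x, y⟫_ℝ = ⟪x, Q y⟫_ℝ) (hQidem : ∀ x : F, Q (Q x) = Q x) (hres : α Acl + B = Q B) :
    hForm α B Acl = (1 / 2) * ⟪B, Q B⟫_ℝ := by
  unfold hForm
  rw [hres, ← real_inner_self_eq_norm_sq, hQself, hQidem]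

end PropA1

/-! ## (A7)–(A16): Proposition A3 -/

/-- Abstract carrier for Proposition A3, pp. 327–328 [PDF 29–30]: the finite-dimensional space ℋ as a real vector space with the
inner product ⟨·,·⟩ (`ip`), the linear operators Δ, V, Δ₀ = Δ↾ℋ₀ (A8) extended by the instance to ℋ, G = (Δ+V)^{−1} (A11), the
projection P of ℋ onto ℋ₀ = Null V orthogonal in the inner product (A12) (x,y) ≡ ⟨x,(Δ+V)y⟩, the transformation C of (A7) (defined in
print by the Gaussian integral over ℋ₀) and the map H of (A15); standing assumptions (A9)–(A10) as Prop fields are not needed for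
the statements and are recorded in the docstrings.  Carrier clauses (F6): the Gaussian definition (A7) of C, the membership
predicate of ℋ₀ (`inH0`). [cite: BalabanImbrieJaffe1985, (A7)–(A12) pp.327–328] -/
structure ConstrainedForm where
  /-- ℋ -/
  H : Type
  [acg : AddCommGroup H]
  [mod : Module ℝ H]
  /-- ⟨x, y⟩ -/
  ip : H → H → ℝ
  /-- x ∈ ℋ₀ = Null V -/
  inH0 : H → Prop
  /-- Δ -/
  Δ : H →ₗ[ℝ] H
  /-- V -/
  V : H →ₗ[ℝ] H
  /-- Δ₀ = Δ↾ℋ₀ (as an operator of ℋ agreeing with Δ on ℋ₀) -/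
  Δ₀ : H →ₗ[ℝ] H
  /-- G = (Δ + V)^{−1}, (A11) -/
  G : H →ₗ[ℝ] H
  /-- P, the projection onto ℋ₀ orthogonal in (x,y) = ⟨x,(Δ+V)y⟩, (A12) -/
  P : H →ₗ[ℝ] H
  /-- C, the transformation defined by the constrained Gaussian integral (A7) -/
  C : H →ₗ[ℝ] H

namespace ConstrainedForm

variable (Q : ConstrainedForm)

/-- plumbing (API for the carrier of Prop. A3 (A7)–(A12)): the additive group of ℋ. [cite: BalabanImbrieJaffe1985, Prop. A3 p.328] -/
instance instACG : AddCommGroup Q.H := Q.acg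

/-- plumbing (API for the carrier of Prop. A3 (A7)–(A12)): the real vector space ℋ. [cite: BalabanImbrieJaffe1985, Prop. A3 p.328] -/
instance instMod : Module ℝ Q.H := Q.mod

/-- **(A13)** p. 328 [PDF 30], verbatim: *"Proposition A3. Under the assumptions above, C = PG, (A13) so Range C ⊂ ℋ₀."*
[cite: BalabanImbrieJaffe1985, Prop. A3 (A13) p.328] -/
def EqA13 (Q₀ : ConstrainedForm) : Prop :=
  Q₀.C = Q₀.P ∘ₗ Q₀.G

/-- **(A14)** p. 328 [PDF 30], verbatim: *"Furthermore CΔ₀C = C, (A14)"*. [cite: BalabanImbrieJaffe1985, Prop. A3 (A14) p.328] -/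
def EqA14 (Q₀ : ConstrainedForm) : Prop :=
  Q₀.C ∘ₗ Q₀.Δ₀ ∘ₗ Q₀.C = Q₀.C

/-- **(A15)–(A16)** p. 328 [PDF 30], verbatim: *"and HB = CB = Z^{−1}∫_{ℋ₀} exp(−½⟨x,Δx⟩ + ⟨x,B⟩)x dx. (A15) is the minimum configuration
of ½⟨x,Δx⟩ − ⟨x,B⟩, x ∈ ℋ₀. Thus with x = y + CB, ½⟨x,Δx⟩ − ⟨x,B⟩ = ½⟨y,Δy⟩ − ½⟨B,CB⟩, x ∈ ℋ₀. (A16)"* — typed: CB ∈ ℋ₀ minimizes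
the form on ℋ₀, and the displayed identity (A16) for x ∈ ℋ₀, y = x − CB. [cite: BalabanImbrieJaffe1985, Prop. A3 (A15)–(A16) p.328] -/
def EqA15A16 (Q₀ : ConstrainedForm) : Prop :=
  ∀ B : Q₀.H, Q₀.inH0 (Q₀.C B) ∧
    (∀ x : Q₀.H, Q₀.inH0 x →
      (1 / 2) * Q₀.ip (Q₀.C B) (Q₀.Δ (Q₀.C B)) - Q₀.ip (Q₀.C B) B ≤ (1 / 2) * Q₀.ip x (Q₀.Δ x) - Q₀.ip x B) ∧
    (∀ x : Q₀.H, Q₀.inH0 x →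
      (1 / 2) * Q₀.ip x (Q₀.Δ x) - Q₀.ip x B
        = (1 / 2) * Q₀.ip (x - Q₀.C B) (Q₀.Δ (x - Q₀.C B)) - (1 / 2) * Q₀.ip B (Q₀.C B))

/-- **Proposition A3** p. 328 [PDF 30]: the conjunction (A13) ∧ (A14) ∧ (A15)–(A16), under the standing assumptions p. 328: *"Let V be
given and I ≤ Δ₀ on ℋ₀, (A9) I ≤ Δ + V on ℋ, (A10) where ℋ₀ = Null V. With these definitions, define G = (Δ+V)^{−1} (A11) and let ( , )
be the inner product (x,y) ≡ ⟨x,(Δ+V)y⟩. (A12) Then let P denote the projection of ℋ onto ℋ₀, where P is orthogonal in the inner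
product (A12)."*  Printed proof: pp. 328–329 ((A17)–(A18) for (A13); the chain for (A14) is `eqA14_of_A13`).
[cite: BalabanImbrieJaffe1985, Prop. A3 p.328] -/
def PropA3 (Q₀ : ConstrainedForm) : Prop :=
  Q₀.EqA13 ∧ Q₀.EqA14 ∧ Q₀.EqA15A16

/-- **The printed verification of (A14)** p. 328 [PDF 30], verbatim: *"To verify (A14), note that CΔ₀C = PGΔ₀PG = PG(Δ+V)PG = P²G =
PG = C."* — KERNEL-CHECKED as operator algebra from exactly the facts used: (A13) C = PG; Δ₀ agrees with Δ + V on the range of P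
(Range P = ℋ₀, Δ₀ = Δ↾ℋ₀ and V = 0 on ℋ₀ = Null V); G(Δ+V) = I (A11); P² = P. [cite: BalabanImbrieJaffe1985, Prop. A3 (A14) p.328] -/
theorem eqA14_of_A13 (hA13 : Q.EqA13) (hΔ₀ : ∀ x : Q.H, Q.Δ₀ (Q.P x) = (Q.Δ + Q.V) (Q.P x))
    (hG : ∀ x : Q.H, Q.G ((Q.Δ + Q.V) x) = x) (hP : ∀ x : Q.H, Q.P (Q.P x) = Q.P x) : Q.EqA14 := by
  unfold EqA14
  unfold EqA13 at hA13
  ext x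
  rw [hA13]
  simp only [LinearMap.coe_comp, Function.comp_apply]
  rw [hΔ₀, hG, hP]

end ConstrainedForm

end Literature.MathematicalPhysics.QuantumFieldTheory.BalabanImbrieJaffe1984to88.BIJ85AppAStatements
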